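import Literature.Topology.FourManifolds.SurfaceGroupCutKernelMoves
import HarnessLib

/-!
# Automorphisms of the surface group stabilising cut kernels, II: the two-handle move of type (C)
# at an arbitrary pair of handles

Topic `Literature/Topology/FourManifolds`; theorems only, sequel to `SurfaceGroupCutKernelMoves.lean`.
Zieschang–Vogt–Coldewey's automorphism `α` of type (C) (LNM 835, p. 79: `t₁ ↦ t₁t₂`,
`u₁ ↦ t₂⁻¹u₁t₂`, `t₂ ↦ t₂⁻¹u₁t₂u₁⁻¹t₂`, `u₂ ↦ u₂t₂⁻¹u₁⁻¹t₂`, fixing `[t₁,u₁][t₂,u₂]` on the nose)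
is placed at an ARBITRARY pair of handles `k < l` of `S_g = ⟨a₀,b₀,…,a_{g-1},b_{g-1} ∣ ∏[aᵢ,bᵢ]⟩`
(`t₁,u₁ = a_k,b_k`, `t₂,u₂ = a_l,b_l`), the letters of the far handle being conjugated by the
middle block `m = mid k l = ∏_{k<h<l}[a_h,b_h]` so that the block `[a_k,b_k]·m·[a_l,b_l]` of the
relator is fixed on the nose (`SurfaceGroup.blockGens`, as for the handle slides of
`SurfaceGroupHandleMoves.lean`; all free-group identities are discharged by `group`):

  `a_k ↦ a_k (m a_l m⁻¹)`, `b_k ↦ (m a_l⁻¹ m⁻¹) b_k (m a_l m⁻¹)`,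
  `a_l ↦ a_l⁻¹ (m⁻¹b_k m) a_l (m⁻¹b_k⁻¹m) a_l`, `b_l ↦ b_l a_l⁻¹ (m⁻¹ b_k⁻¹ m) a_l`.

* `SurfaceGroup.exists_realises_moveZ_gt` — this automorphism realises the elementary
  symplectic move `moveZ l k 1 : δ_{a_k} ↦ δ_{a_k} + δ_{a_l}, δ_{b_l} ↦ δ_{b_l} - δ_{b_k}` on `H₁`
  (ZVC 3.6.9 (C)), and it STABILISES EVERY CUT KERNEL `cutKernel c` WITH `c l = false ∨ c k = true`
  (i.e. unless `c` cuts `b_l` and `a_k`: the image of `a_k` involves `a_l`), by the erasure test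
  of `SurfaceGroupCutKernels.lean` on the eight generator images.

## References

* H. Zieschang, E. Vogt, H.-D. Coldewey, *Surfaces and Planar Discontinuous Groups*, LNM 835
  (1980), §3.6, 3.6.9 (C) and p. 79. [ZieschangVogtColdewey1980]
-/

noncomputable section

namespace Literature.Topology.FourManifolds

open Multiplicative Subgroup

namespace SurfaceGroup

variable {g : ℕ}

/-- **ZVC's move of type (C) at the handles `k < l`, stabilising cut kernels.**  There is an
automorphism `x` of `S_g` realising `moveZ l k 1` on `H₁` (`δ_{a_k} ↦ δ_{a_k} + δ_{a_l}`,
`δ_{b_l} ↦ δ_{b_l} - δ_{b_k}`, all other basis vectors fixed) which stabilises every cut kernel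
`cutKernel c` with `c l = false ∨ c k = true`. [cite: ZieschangVogtColdewey1980, 3.6.9 (C)] -/
theorem exists_realises_moveZ_gt {k l : Fin g} (hkl : k < l) :
    ∃ x : SurfaceGroup g ≃* SurfaceGroup g,
      (∀ c : Fin g → Bool, (c l = false ∨ c k = true) →
        (cutKernel c).map x.toMonoidHom = cutKernel c) ∧
      ∀ s, toAdd (SurfaceGroup.abelianize g (x s)) =
        moveZ l k hkl.ne' 1 (toAdd (SurfaceGroup.abelianize g s)) := by
  -- the eight generator images (`m = mid k l`)
  let m : SurfaceGroup g := mid k l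
  let Ak : SurfaceGroup g := a k * m * a l * m⁻¹
  let Bk : SurfaceGroup g := m * (a l)⁻¹ * m⁻¹ * b k * m * a l * m⁻¹
  let Al : SurfaceGroup g := (a l)⁻¹ * m⁻¹ * b k * m * a l * m⁻¹ * (b k)⁻¹ * m * a l
  let Bl : SurfaceGroup g := b l * (a l)⁻¹ * m⁻¹ * (b k)⁻¹ * m * a l
  let Ak' : SurfaceGroup g := a k * (b k)⁻¹ * m * (a l)⁻¹ * m⁻¹ * b k
  let Bk' : SurfaceGroup g := (b k)⁻¹ * m * a l * m⁻¹ * b k * m * (a l)⁻¹ * m⁻¹ * b k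
  let Al' : SurfaceGroup g := m⁻¹ * (b k)⁻¹ * m * a l * m⁻¹ * b k * m
  let Bl' : SurfaceGroup g := b l * m⁻¹ * b k * m
  -- the automorphism and its values on the letters
  obtain ⟨x, hxak, hxbk, hxal, hxbl, hxne, hyak, hybk, hyal, hybl, hyne⟩ :
      ∃ x : SurfaceGroup g ≃* SurfaceGroup g,
        x (a k) = Ak ∧ x (b k) = Bk ∧ x (a l) = Al ∧ x (b l) = Bl ∧
        (∀ i, i ≠ k → i ≠ l → ∀ s, x (PresentedGroup.of (i, s)) = PresentedGroup.of (i, s)) ∧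
        x.symm (a k) = Ak' ∧ x.symm (b k) = Bk' ∧ x.symm (a l) = Al' ∧ x.symm (b l) = Bl' ∧
        (∀ i, i ≠ k → i ≠ l → ∀ s, x.symm (PresentedGroup.of (i, s)) = PresentedGroup.of (i, s)) := by
    refine ⟨equivOfGens (blockGens k l Ak Bk Al Bl) (blockGens k l Ak' Bk' Al' Bl')
      (prod_relFactor_blockGens hkl _ _ _ _ (by simp only [Ak, Bk, Al, Bl, m]; group))
      (prod_relFactor_blockGens hkl _ _ _ _ (by simp only [Ak', Bk', Al', Bl', m]; group))
      ?_ ?_, ?_, ?_, ?_, ?_, ?_, ?_, ?_, ?_, ?_, ?_⟩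
    · rintro ⟨i, s⟩
      by_cases hik : i = k
      · subst hik; cases s
        · rw [← a_def]; simp [hkl, map_mul, map_inv, Ak, Ak', Al', m]; group
        · rw [← b_def]; simp [hkl, map_mul, map_inv, Bk, Bk', Al', m]; group
      by_cases hil : i = l
      · subst hil; cases s
        · rw [← a_def]; simp [hkl, map_mul, map_inv, Al, Bk', Al', m]; group
        · rw [← b_def]; simp [hkl, map_mul, map_inv, Bl, Bk', Al', Bl', m]; group
      simp [blockGens_of_ne _ _ _ _ hik hil]
    · rintro ⟨i, s⟩
      by_cases hik : i = k
      · subst hik; cases s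
        · rw [← a_def]; simp [hkl, map_mul, map_inv, Ak', Ak, Bk, Al, m]; group
        · rw [← b_def]; simp [hkl, map_mul, map_inv, Bk', Bk, Al, m]; group
      by_cases hil : i = l
      · subst hil; cases s
        · rw [← a_def]; simp [hkl, map_mul, map_inv, Al', Bk, Al, m]; group
        · rw [← b_def]; simp [hkl, map_mul, map_inv, Bl', Bk, Bl, m]; group
      simp [blockGens_of_ne _ _ _ _ hik hil]
    · simp [a_def k]
    · simp [b_def k]
    · simp [a_def l, hkl]
    · simp [b_def l, hkl]
    · intro i hik hil s; simp [blockGens_of_ne _ _ _ _ hik hil]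
    · simp [a_def k]
    · simp [b_def k]
    · simp [a_def l, hkl]
    · simp [b_def l, hkl]
    · intro i hik hil s; simp [blockGens_of_ne _ _ _ _ hik hil]
  have hlk : l ≠ k := hkl.ne'
  refine ⟨x, fun c hc => ?_, ?_⟩
  · -- stabilising the cut kernels: the erasure test on the images of the cut letters
    refine map_cutKernel_eq_of x c c (fun i => ?_) (fun i => ?_)
    · by_cases hik : i = k
      · subst hik
        cases hck : c i
        · have hcl : c l = false := by
            rcases hc with h | h
            · exact h
            · rw [hck] at h; exact absurd h (by decide)
          rw [← a_def, hxak]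
          simp only [Ak, m, map_mul, map_inv, erase_a_of_eq_false c hck, erase_a_of_eq_false c hcl,
            erase_mid]
          group
        · rw [← b_def, hxbk]
          simp only [Bk, m, map_mul, map_inv, erase_b_of_eq_true c hck, erase_mid]
          group
      by_cases hil : i = l
      · subst hil
        cases hcl : c i
        · rw [← a_def, hxal]
          simp only [Al, m, map_mul, map_inv, erase_a_of_eq_false c hcl, erase_mid]
          group
        · have hck : c k = true := by
            rcases hc with h | h
            · rw [hcl] at h; exact absurd h (by decide)
            · exact h
          rw [← b_def, hxbl]
          simp only [Bl, m, map_mul, map_inv, erase_b_of_eq_true c hcl, erase_b_of_eq_true c hck,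
            erase_mid]
          group
      rw [hxne i hik hil]
      exact erase_of_cut c i
    · by_cases hik : i = k
      · subst hik
        cases hck : c i
        · have hcl : c l = false := by
            rcases hc with h | h
            · exact h
            · rw [hck] at h; exact absurd h (by decide)
          rw [← a_def, hyak]
          simp only [Ak', m, map_mul, map_inv, erase_a_of_eq_false c hck, erase_a_of_eq_false c hcl,
            erase_mid]
          group
        · rw [← b_def, hybk]
          simp only [Bk', m, map_mul, map_inv, erase_b_of_eq_true c hck, erase_mid]
          group
      by_cases hil : i = l
      · subst hil
        cases hcl : c i
        · rw [← a_def, hyal]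
          simp only [Al', m, map_mul, map_inv, erase_a_of_eq_false c hcl, erase_mid]
          group
        · have hck : c k = true := by
            rcases hc with h | h
            · rw [hcl] at h; exact absurd h (by decide)
            · exact h
          rw [← b_def, hybl]
          simp only [Bl', m, map_mul, map_inv, erase_b_of_eq_true c hcl, erase_b_of_eq_true c hck,
            erase_mid]
          group
      rw [hyne i hik hil]
      exact erase_of_cut c i
  · -- the homology action
    refine abelianize_comp_eq_of_apply_of x _ ?_
    rintro ⟨i, s⟩
    by_cases hik : i = k
    · subst hik
      cases s
      · rw [← a_def, hxak, moveZ_single_false hlk, one_smul]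
        simp only [Ak, m, map_mul, map_inv, toAdd_mul, toAdd_inv, abelianize_a, abelianize_mid,
          toAdd_one, toAdd_ofAdd]
        abel
      · rw [← b_def, hxbk, moveZ_single_of_ne hlk 1 (by simp) (by simp [hkl.ne])]
        simp only [Bk, m, map_mul, map_inv, toAdd_mul, toAdd_inv, abelianize_a, abelianize_b,
          abelianize_mid, toAdd_one, toAdd_ofAdd]
        abel
    by_cases hil : i = l
    · subst hil
      cases s
      · rw [← a_def, hxal, moveZ_single_of_ne hlk 1 (by simp [hlk]) (by simp)]
        simp only [Al, m, map_mul, map_inv, toAdd_mul, toAdd_inv, abelianize_a, abelianize_b,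
          abelianize_mid, toAdd_one, toAdd_ofAdd]
        abel
      · rw [← b_def, hxbl, moveZ_single_true hlk, one_smul]
        simp only [Bl, m, map_mul, map_inv, toAdd_mul, toAdd_inv, abelianize_a, abelianize_b,
          abelianize_mid, toAdd_one, toAdd_ofAdd]
        abel
    · rw [hxne i hik hil, moveZ_single_of_ne hlk 1 (by simp [hik]) (by simp [hil])]
      simp

end SurfaceGroup

end Literature.Topology.FourManifolds

end
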